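import Literature.AlgebraicGeometry.Motives.AbelianVarietyCotangent
import Literature.RingTheory.Localization.CotangentAtMaximalIdeal
import HarnessLib

/-!
# The cotangent space of an abelian variety at the origin, read on an affine chart: `𝔪_e/𝔪_e² = 𝔪_U/𝔪_U²`

Topic `Literature/AlgebraicGeometry/Motives`, namespace `Literature.AlgebraicGeometry.Motives.AbelianVariety`.  THEOREMS and one
`def` (a linear equivalence); no named fact (net debt 0).  Cell `hodgecm-mathlib`, row II-2β (`shimura1998_prop26_definedOverQbar`
`_holds`, plan `PREP-II2beta-Prop26Qbar.md`), brick F1b (G1): the tree's cotangent space `AbelianVariety.Cotangent A = 𝔪_e/𝔪_e²`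
(the STALK `𝒪_{A,e}`, `Motives/AbelianVarietyCotangent`) versus the cotangent module `𝔪_U/𝔪_U²` of the maximal ideal `𝔪_U` of
the origin in the ring `Γ(A, U)` of an AFFINE open `U ∋ e` — the form in which a model of `A` over a ring delivers it
(`RingTheory/Smooth/AugmentationIdealCotangentBaseChange`).

THE PRINT.  Görtz–Wedhorn, *Algebraic Geometry I*, 2nd ed., §6.3 (6.3.1)–Remark 6.4 («Let `X = Spec A`, `x ∈ X` a closed point with
maximal ideal `𝔪 ⊂ A` … `T_x X = (𝔪/𝔪²)^*` … since `𝔪_x/𝔪_x² = 𝔪/𝔪²`») and Def. 6.2 (the Zariski cotangent space `𝔪_x/𝔪_x²`):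
the stalk `𝒪_{A,e}` is the localisation of `Γ(A, U)` at `𝔪_U` (Mathlib `IsAffineOpen.isLocalization_stalk`), `𝔪_U` is maximal
(`e` is a closed point, `IsAffineOpen.primeIdealOf_isMaximal_of_isClosed`), and localising does not change `𝔪/𝔪²` at a
maximal ideal (`RingTheory/Localization/CotangentAtMaximalIdeal.cotangentLocalizationEquiv`).

WHAT IS PROVED (`A : AbelianVariety K`, `U` an affine open of `A` containing the origin `e`; the `Γ(A, U)`-algebra structure
on `𝒪_{A,e}` is Mathlib's `TopCat.Presheaf.algebra_section_stalk`, i.e. the germ map):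
* `chartIdeal A hU he` — `𝔪_U = (primeIdealOf e).asIdeal ⊆ Γ(A, U)`, maximal (`chartIdeal_isMaximal`);
* **`cotangentChartEquiv A hU he : (chartIdeal A hU he).Cotangent ≃ₗ[Γ(A, U)] AbelianVariety.Cotangent A`** and its value on
  classes `cotangentChartEquiv_toCotangent` (the class of `f ∈ 𝔪_U` goes to the class of the germ `f_e ∈ 𝔪_e`).
* (G2) `appLE_mem_chartIdeal`, **`cotangentMap_cotangentChartEquiv`** — EQUIVARIANCE (Görtz–Wedhorn I, Remark 6.3 (3): the map
  of cotangent spaces induced by `f_x^♯`): for an endomorphism `u` of `A` and affine charts `V ⊆ u⁻¹U` of `e`, `u^*` on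
  `𝔪_e/𝔪_e²` read through the chart isomorphisms is `u^♯ = appLE U V : 𝔪_U/𝔪_U² → 𝔪_V/𝔪_V²` (for `u = 𝟙`: nested charts
  are compatible);
* (G2′) `cotangentChartEquiv_toCotangent_const_mul` — the chart isomorphism matches multiplication by the constants
  `K → Γ(A, U)` with the `K`-vector space structure of `AbelianVariety.Cotangent A`.
The fibre charts of a model over a ring (G3) are the sequel (`Morphisms/AffineBaseChangeChart.isPushout_chart` +
`RingTheory/Smooth/AugmentationIdealCotangentBaseChange`), written against the carrier of the spread (A-p14/A-p11).

## References
* [GortzWedhorn2020] U. Görtz, T. Wedhorn, *Algebraic Geometry I*, 2nd ed. (2020), Def. 6.2, §6.3 (6.3.1), Remark 6.3 (3), Remark 6.4.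
-/

universe u

open CategoryTheory AlgebraicGeometry

noncomputable section

namespace Literature.AlgebraicGeometry.Motives

namespace AbelianVariety

variable {K : Type u} [Field K] (A : AbelianVariety K) {U : A.X.left.Opens} (hU : IsAffineOpen U) (he : origin A ∈ U)

/-- The origin of an abelian variety is a closed point (the unit section is a closed immersion with image `{e}`,
`range_unitPt`). [cite: GortzWedhorn2020, Prop. 3.33] -/
private theorem isClosed_origin' : IsClosed ({origin A} : Set A.X.left) := by
  rw [← range_unitPt]
  exact (unitPt A).isClosedEmbedding.isClosed_range

/-- **`𝔪_U ⊆ Γ(A, U)`**: the (maximal) ideal of the origin in the coordinate ring of an affine open `U ∋ e` — the prime of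
`Spec Γ(A, U) ≅ U` corresponding to `e` (Mathlib `IsAffineOpen.primeIdealOf`). [cite: GortzWedhorn2020, §6.3 (6.3.1) and Remark 6.4] -/
abbrev chartIdeal : Ideal Γ(A.X.left, U) := (hU.primeIdealOf ⟨origin A, he⟩).asIdeal

/-- `𝔪_U` is maximal: the origin is a closed point. [cite: GortzWedhorn2020, §6.3 (6.3.1) and Remark 6.4; Prop. 3.33] -/
theorem chartIdeal_isMaximal : (chartIdeal A hU he).IsMaximal :=
  hU.primeIdealOf_isMaximal_of_isClosed ⟨origin A, he⟩ (isClosed_origin' A)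

/-- **`𝒪_{A,e}` is the localisation of `Γ(A, U)` at `𝔪_U`** (Mathlib `IsAffineOpen.isLocalization_stalk`, for the germ
algebra structure `algebra_section_stalk`). [cite: GortzWedhorn2020, §6.3 (6.3.1) and Remark 6.4] -/
theorem isLocalization_stalkOrigin :
    letI := TopCat.Presheaf.algebra_section_stalk A.X.left.presheaf ⟨origin A, he⟩
    IsLocalization.AtPrime (stalkOrigin A) (chartIdeal A hU he) :=
  hU.isLocalization_stalk ⟨origin A, he⟩

/-- **`𝔪_U/𝔪_U² ≅ 𝔪_e/𝔪_e²`**: the cotangent module of the ideal of the origin in an affine chart `U ∋ e` is the cotangent space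
of `A` at the origin (`AbelianVariety.Cotangent A = 𝔪_e/𝔪_e²` of the stalk), `Γ(A, U)`-linearly — «`𝔪_x/𝔪_x² = 𝔪/𝔪²`».
[cite: GortzWedhorn2020, §6.3 (6.3.1) and Remark 6.4; Def. 6.2] -/
def cotangentChartEquiv :
    letI := TopCat.Presheaf.algebra_section_stalk A.X.left.presheaf ⟨origin A, he⟩
    (chartIdeal A hU he).Cotangent ≃ₗ[Γ(A.X.left, U)] (IsLocalRing.maximalIdeal (stalkOrigin A)).Cotangent :=
  letI := TopCat.Presheaf.algebra_section_stalk A.X.left.presheaf ⟨origin A, he⟩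
  haveI := chartIdeal_isMaximal A hU he
  haveI := isLocalization_stalkOrigin A hU he
  Literature.RingTheory.Localization.cotangentLocalizationEquiv (chartIdeal A hU he) (stalkOrigin A)

/-- Value on classes: the class of `f ∈ 𝔪_U` goes to the class of its germ `f_e ∈ 𝔪_e`.
[cite: GortzWedhorn2020, §6.3 (6.3.1) and Remark 6.4] -/
theorem cotangentChartEquiv_toCotangent (f : chartIdeal A hU he) :
    letI := TopCat.Presheaf.algebra_section_stalk A.X.left.presheaf ⟨origin A, he⟩
    cotangentChartEquiv A hU he ((chartIdeal A hU he).toCotangent f) =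
      (IsLocalRing.maximalIdeal (stalkOrigin A)).toCotangent
        ⟨A.X.left.presheaf.germ U (origin A) he f.1,
          by
            haveI := chartIdeal_isMaximal A hU he
            haveI := isLocalization_stalkOrigin A hU he
            exact Literature.RingTheory.Localization.le_comap_maximalIdeal (chartIdeal A hU he) (stalkOrigin A) f.2⟩ := by
  letI := TopCat.Presheaf.algebra_section_stalk A.X.left.presheaf ⟨origin A, he⟩
  haveI := chartIdeal_isMaximal A hU he
  haveI := isLocalization_stalkOrigin A hU he
  exact Literature.RingTheory.Localization.cotangentLocalizationEquiv_toCotangent _ _ f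

/-- The target of `cotangentChartEquiv` IS the tree's `AbelianVariety.Cotangent A` (definitionally `𝔪_e/𝔪_e²` of the stalk).
[cite: GortzWedhorn2020, Def. 6.2] -/
theorem cotangent_eq_maximalIdeal_cotangent :
    Cotangent A = (IsLocalRing.maximalIdeal (stalkOrigin A)).Cotangent := rfl

/-! ### (G2) Equivariance under endomorphisms: `u^*` on `𝔪_e/𝔪_e²` is `u^♯` on the charts -/

/-- **An endomorphism `u` of `A` maps the ideal of the origin of a chart `U` into that of a chart `V ⊆ u⁻¹U`**:
`u^♯ = appLE U V : Γ(A, U) → Γ(A, V)` carries `𝔪_U` into `𝔪_V` (`u(e) = e`; Mathlib `comap_primeIdealOf_appLE`).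
[cite: GortzWedhorn2020, Remark 6.3 (3)] -/
theorem appLE_mem_chartIdeal (u : A ⟶ A) {V : A.X.left.Opens} (hV : IsAffineOpen V) (heV : origin A ∈ V)
    (hVU : V ≤ (Hom.toSchemeHom u) ⁻¹ᵁ U) (f : chartIdeal A hU he) :
    (Hom.toSchemeHom u).appLE U V hVU f.1 ∈ chartIdeal A hV heV := by
  have h := IsAffineOpen.comap_primeIdealOf_appLE (f := Hom.toSchemeHom u) (x := origin A) U hU V hV hVU heV
  have he' : (⟨(Hom.toSchemeHom u).base (origin A), hVU heV⟩ : U) = ⟨origin A, he⟩ :=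
    Subtype.ext (toSchemeHom_origin u)
  have hf : f.1 ∈ (hU.primeIdealOf ⟨(Hom.toSchemeHom u).base (origin A), hVU heV⟩).asIdeal := by
    rw [he']; exact f.2
  rw [← h] at hf
  exact hf

/-- **`u^*` on `𝔪_e/𝔪_e²` read on charts is `u^♯ : 𝔪_U/𝔪_U² → 𝔪_V/𝔪_V²`**: for an endomorphism `u` of `A` and affine charts
`U, V ∋ e` with `V ⊆ u⁻¹U`, the cotangent map `cotangentMap A u` (the tree's `u^*`, through the stalk map) sends the class of
`f ∈ 𝔪_U` (read in `𝔪_e/𝔪_e²` through `cotangentChartEquiv` for `U`) to the class of `u^♯ f|_V ∈ 𝔪_V` (read through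
`cotangentChartEquiv` for `V`) — Görtz–Wedhorn I, Remark 6.3 (3): the map on cotangent spaces induced by `f_x^♯` on germs.
The case `u = 𝟙` is the compatibility of the chart isomorphisms for nested charts `V ⊆ U`.
[cite: GortzWedhorn2020, Remark 6.3 (3); §6.3 (6.3.1)] -/
theorem cotangentMap_cotangentChartEquiv (u : A ⟶ A) {V : A.X.left.Opens} (hV : IsAffineOpen V) (heV : origin A ∈ V)
    (hVU : V ≤ (Hom.toSchemeHom u) ⁻¹ᵁ U) (f : chartIdeal A hU he) :
    letI := TopCat.Presheaf.algebra_section_stalk A.X.left.presheaf ⟨origin A, he⟩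
    letI := TopCat.Presheaf.algebra_section_stalk A.X.left.presheaf ⟨origin A, heV⟩
    cotangentMap A u (cotangentChartEquiv A hU he ((chartIdeal A hU he).toCotangent f)) =
      cotangentChartEquiv A hV heV ((chartIdeal A hV heV).toCotangent
        ⟨(Hom.toSchemeHom u).appLE U V hVU f.1, appLE_mem_chartIdeal A hU he u hV heV hVU f⟩) := by
  rw [cotangentChartEquiv_toCotangent, cotangentChartEquiv_toCotangent]
  change cotangentMap A u (Cotangent.mk A _) = Cotangent.mk A _
  rw [cotangentMap_mk]
  congr 1
  apply Subtype.ext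
  change stalkMapEnd A u (A.X.left.presheaf.germ U (origin A) he f.1) =
    A.X.left.presheaf.germ V (origin A) heV ((Hom.toSchemeHom u).appLE U V hVU f.1)
  have h := congrArg (fun φ => φ.hom f.1) (germ_stalkMapEnd u U he)
  simp only [CommRingCat.hom_comp, RingHom.comp_apply] at h
  rw [h, Scheme.Hom.appLE]
  exact (TopCat.Presheaf.germ_res_apply A.X.left.presheaf (homOfLE hVU) (origin A) heV _).symm

/-! ### (G2′) Scalars: the chart isomorphism is `K`-linear for the constants `K → Γ(A, U)` -/

/-- **The chart isomorphism `𝔪_U/𝔪_U² ≅ 𝔪_e/𝔪_e²` is compatible with the scalars of `K`**: multiplying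
`f ∈ 𝔪_U` by the constant function `c|_U` (`c ∈ K`, pulled back along the structure morphism `A → Spec K` and
restricted to `U`) multiplies its class in `𝔪_e/𝔪_e² = T_e^*(A)` by `c` for the `K`-vector space structure of
`AbelianVariety.Cotangent A` (through `K → 𝒪_{A,e}`, `stalkOriginAlgebraMap`) — both are the germ of `c` at `e`
acting on `𝔪_e/𝔪_e²` (Görtz–Wedhorn I, (6.3.1): `T_x X` is a `κ(x)`-vector space, functorially in the chart).
[cite: GortzWedhorn2020, §6.3 (6.3.1) and Remark 6.3 (3)] -/
theorem cotangentChartEquiv_toCotangent_const_mul (c : K) (f : chartIdeal A hU he) :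
    letI := TopCat.Presheaf.algebra_section_stalk A.X.left.presheaf ⟨origin A, he⟩
    letI : Module K (IsLocalRing.maximalIdeal (stalkOrigin A)).Cotangent := Cotangent.instModule (A := A)
    cotangentChartEquiv A hU he ((chartIdeal A hU he).toCotangent
        ⟨A.X.hom.appLE ⊤ U le_top ((Scheme.ΓSpecIso (.of K)).inv c) * f.1, Ideal.mul_mem_left _ _ f.2⟩) =
      c • cotangentChartEquiv A hU he ((chartIdeal A hU he).toCotangent f) := by
  rw [cotangentChartEquiv_toCotangent, cotangentChartEquiv_toCotangent]
  change Cotangent.mk A _ = c • Cotangent.mk A _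
  rw [Cotangent.smul_mk]
  congr 1
  apply Subtype.ext
  change A.X.left.presheaf.germ U (origin A) he (A.X.hom.appLE ⊤ U le_top ((Scheme.ΓSpecIso (.of K)).inv c) * f.1) =
    stalkOriginAlgebraMap A c * A.X.left.presheaf.germ U (origin A) he f.1
  rw [map_mul, stalkOriginAlgebraMap_apply, Scheme.Hom.appLE, CommRingCat.comp_apply]
  congr 1
  exact TopCat.Presheaf.germ_res_apply A.X.left.presheaf (homOfLE le_top) (origin A) he _

end AbelianVariety

end Literature.AlgebraicGeometry.Motives

end
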